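import Mathlib
import HarnessLib
import Summits.HubbardSuperconductivity.HubbardSuperconductivity.Theorems.KLProgrammeKLRegimeSplitFieldStrengthTimeMoment
import Summits.HubbardSuperconductivity.HubbardSuperconductivity.Theorems.KLProgrammeKLRegimeSplitSymInterp
import Literature.Analysis.Complex.OneSidedPowerSum
import Summits.HubbardSuperconductivity.HubbardSuperconductivity.Theorems.KLProgrammeKLRegimeSplitTwoLegReadingSlopesRegime
import Summits.HubbardSuperconductivity.HubbardSuperconductivity.Theorems.KLProgrammeKLRegimeSplitEvalDerivBounds

/-!
# Route `KLProgramme` — ENGINE child 19855, two-leg stubs: the COEFFICIENT MOMENTS of the two-leg data from the SPATIAL MOMENTS of the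
# position-space two-leg kernel — `Σ_y (1+|ỹ₀|+|ỹ₁|)ʲ |torusCosCoeff L (klLocSelfEnergyRe …) y| ≤ 2·Mˢ_j` (generic Fourier inversion)

Cell `gate-hubbard-kl`, seat p1b (g6); TWO-LEG-CLOSERS.md §2 (M1).  Every generic closer of the two-leg slot landed by this lineage
((E3g) `twoLegAngularG/Fn_of_moments…`, (E3e) via `coeffNorm 1`, (E3a) via `norm_iteratedFDeriv_evalM_le_coeffNorm`) consumes the MOMENTS of the
lattice cosine coefficients `torusCosCoeff L σ y` of the two-leg data `σ = klLocSelfEnergyRe … n` (weights `(1+|ỹ₀|+|ỹ₁|)ʲ`).  The fermionic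
expansion bounds POSITION-SPACE kernels.  This file is the bridge, for ANY `G : HubbardGrassmann L M` and `β > 0`: with
`W_σ = sectorisedKernel β 1 G 2 ((σ,+),(σ,−))` (the unsectorised position kernel of the string `ψ⁺_{x₀σ}ψ⁻_{x₁σ}`) and the spatial weight
`w_j(x) = (1 + |x̃(x₁)₀ − x̃(x₀)₀|~ + …)ʲ` read on the torus difference `x⃗₁ − x⃗₀`,

  `Σ_y w_j(y) |torusCosCoeff L (k⃗ ↦ Re Σ((ω,k⃗),σ)) y| ≤ 2·Mˢ`   whenever   `ε_x Σ_{x : x 0 = x₀} w_j(x⃗₁ − x⃗₀) ‖W_σ(x)‖ ≤ Mˢ` for all `x₀`,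

for every kept frequency `ω` (`sum_weight_abs_torusCosCoeff_re_selfEnergy_le`), hence the same for the `±ω₀`/spin average
`klLocSelfEnergyRe … n` of the cell (`sum_weight_abs_torusCosCoeff_klLocSelfEnergyRe_le`).  Mechanism: `|Λ|² F₂((ω,k⃗)) = Σ_x W(x) e^{iωΔt} χ_{k⃗}(x⃗₀ − x⃗₁)`
(inversion, `…FieldStrengthTimeMoment`), `Σ_{k⃗} χ_{k⃗}(x⃗₀ − x⃗₁) χ_{k⃗}(y) = L²·[x⃗₁ − x⃗₀ = y]` (`sum_torusChar_left`), `Re a · Re χ = ½Re(aχ) + ½Re(a χ̄)`,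
`Σ = 2βL²·F₂`, `βL² = ε_x |Λ|`, and the average over `x₀` is below the sup.

Everything is PROVED; no definitions; nothing about the model is asserted.  References: BGM 2006 §2.1 (2.4)–(2.5), (2.17), (2.36)
[cite: BenfattoGiulianiMastropietro2006].
-/

noncomputable section

namespace Summit.HubbardSuperconductivity.HubbardSuperconductivity.Theorems.TwoLegFourier

set_option linter.dupNamespace false -- summit = problem name (single-conjunct summit), D-0017

open Finset Complex
open Literature.MathematicalPhysics.QuantumLattice Literature.Probability.LatticeModels GrassmannAlgebra
open Summit.HubbardSuperconductivity.HubbardSuperconductivity.Theorems.KLRegimeSplit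

variable {L M : ℕ} [NeZero L]

/-! ## §1 The two-leg coefficient in position space, spatial part as a character -/

/-- The testing phase of the string `(K,+)(K,−)` factorises: `exp(i(K·y − K·y′)) = e^{iω_n (t_y − t_{y′})} · χ_{k⃗}(y⃗ − y⃗′)`. -/
theorem conj_phase_eq_cexp_mul_torusChar (β : ℝ) (K : FreqMomentum L M) (y y' : SpaceTimeIdx L M) :
    (starRingEnd ℂ) (hubbardPlaneWave L M β 0 K y * hubbardPlaneWave L M β 1 K y') =
      Complex.exp (((matsubaraFreq β M K.1 * (imagTime β M y.1 - imagTime β M y'.1) : ℝ) : ℂ) * I) *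
        torusChar K.2 (y.2 - y'.2) := by
  rw [conj_hubbardPlaneWave_zero_mul_one, torusChar_sub_right, ← cexp_sum_latticeMomentum_mul_eq_torusChar,
    ← cexp_sum_latticeMomentum_mul_eq_torusChar, ← Complex.exp_conj, map_mul, Complex.conj_ofReal, Complex.conj_I,
    ← Complex.exp_add, ← Complex.exp_add]
  congr 1
  simp only [spaceTimePhase]
  push_cast
  ring

/-- **The two-leg coefficient at `(ω, k⃗)` tested against a spatial character**: for every `y`,
`|Λ|² Σ_{k⃗} F₂((ω,k⃗),σ-string) χ_{k⃗}(y) = L² Σ_{x : x⃗₀ − x⃗₁ + y = 0} W(x) e^{iω(t₀ − t₁)}`. -/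
theorem card_sq_mul_sum_kernel_two_mul_torusChar {β : ℝ} (hβ : β ≠ 0) (G : HubbardGrassmann L M) (n : MatsubaraIdx M) (σ : Fin 2)
    (y : TorusSite 2 L) :
    (Fintype.card (SpaceTimeIdx L M) : ℂ) ^ 2 * ∑ k : TorusSite 2 L, kernel ℂ G 2 ![(((n, k), σ), 0), (((n, k), σ), 1)] * torusChar k y =
      ((L : ℂ) ^ 2) * ∑ x : Fin 2 → SpaceTimeIdx L M,
        if (x 0).2 - (x 1).2 + y = 0 then
          sectorisedKernel L M β (trivialMultiplier L M) G 2 (![((0, σ), 0), ((0, σ), 1)] : Fin 2 → SectorLeg 1) x *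
            Complex.exp (((matsubaraFreq β M n * (imagTime β M (x 0).1 - imagTime β M (x 1).1) : ℝ) : ℂ) * I)
        else 0 := by
  set W := sectorisedKernel L M β (trivialMultiplier L M) G 2 (![((0, σ), 0), ((0, σ), 1)] : Fin 2 → SectorLeg 1) with hW
  rw [mul_sum]
  have hk : ∀ k : TorusSite 2 L, (Fintype.card (SpaceTimeIdx L M) : ℂ) ^ 2 *
      (kernel ℂ G 2 ![(((n, k), σ), 0), (((n, k), σ), 1)] * torusChar k y) =
      ∑ x : Fin 2 → SpaceTimeIdx L M, W x *
        Complex.exp (((matsubaraFreq β M n * (imagTime β M (x 0).1 - imagTime β M (x 1).1) : ℝ) : ℂ) * I) *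
          torusChar k ((x 0).2 - (x 1).2 + y) := by
    intro k
    rw [← mul_assoc, card_sq_mul_kernel_two_eq_sum hβ G (n, k) σ, sum_mul]
    refine sum_congr rfl fun x _ => ?_
    rw [hW, conj_phase_eq_cexp_mul_torusChar, torusChar_add_right]
    ring
  simp_rw [hk]
  rw [sum_comm]
  rw [mul_sum]
  refine sum_congr rfl fun x _ => ?_
  rw [← mul_sum, sum_torusChar_left]
  split_ifs with h
  · push_cast; ring
  · rw [mul_zero, mul_zero]

/-! ## §2 The cosine coefficients of `k⃗ ↦ Re Σ((ω,k⃗),σ)` against the position kernel -/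

/-- Norm of the character-tested two-leg coefficient: `‖Σ_{k⃗} F₂((ω,k⃗)) χ_{k⃗}(z)‖ ≤ L²/|Λ|² · Σ_{x : x⃗₁ − x⃗₀ = z} ‖W(x)‖`. -/
theorem norm_sum_kernel_two_mul_torusChar_le [NeZero M] {β : ℝ} (hβ : β ≠ 0) (G : HubbardGrassmann L M) (n : MatsubaraIdx M)
    (σ : Fin 2) (z : TorusSite 2 L) :
    ‖∑ k : TorusSite 2 L, kernel ℂ G 2 ![(((n, k), σ), 0), (((n, k), σ), 1)] * torusChar k z‖ ≤
      (L : ℝ) ^ 2 / (Fintype.card (SpaceTimeIdx L M) : ℝ) ^ 2 *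
        ∑ x : Fin 2 → SpaceTimeIdx L M, if z = (x 1).2 - (x 0).2 then
          ‖sectorisedKernel L M β (trivialMultiplier L M) G 2 (![((0, σ), 0), ((0, σ), 1)] : Fin 2 → SectorLeg 1) x‖ else 0 := by
  set P : ℝ := (Fintype.card (SpaceTimeIdx L M) : ℝ) with hP
  have hPpos : 0 < P := by
    rw [hP]; exact_mod_cast (Fintype.card_pos_iff.2 ⟨(n, z)⟩ : 0 < Fintype.card (SpaceTimeIdx L M))
  have h := congrArg (fun w : ℂ => ‖w‖) (card_sq_mul_sum_kernel_two_mul_torusChar hβ G n σ z)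
  simp only [norm_mul, norm_pow, Complex.norm_natCast] at h
  rw [← hP] at h
  rw [div_mul_eq_mul_div, le_div_iff₀ (by positivity), mul_comm _ (P ^ 2), h]
  refine mul_le_mul_of_nonneg_left ((norm_sum_le _ _).trans (sum_le_sum fun x _ => ?_)) (by positivity)
  have hiff : (x 0).2 - (x 1).2 + z = 0 ↔ z = (x 1).2 - (x 0).2 := by
    rw [add_eq_zero_iff_neg_eq, neg_sub, eq_comm]
  by_cases hz : z = (x 1).2 - (x 0).2
  · rw [if_pos (hiff.2 hz), if_pos hz, norm_mul, Complex.norm_exp_ofReal_mul_I, mul_one]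
  · rw [if_neg (fun h => hz (hiff.1 h)), if_neg hz, norm_zero]

/-- **Pointwise bound of a cosine coefficient of `Re Σ((ω,·),σ)` by the position kernel**:
`|torusCosCoeff L (k⃗ ↦ Re Σ((ω,k⃗),σ)) y| ≤ β L²/|Λ|² · (Σ_{x : x⃗₁ − x⃗₀ = y} ‖W(x)‖ + Σ_{x : x⃗₁ − x⃗₀ = −y} ‖W(x)‖)`. -/
theorem abs_torusCosCoeff_re_selfEnergy_le [NeZero M] {β : ℝ} (hβ : 0 < β) (G : HubbardGrassmann L M) (n : MatsubaraIdx M)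
    (σ : Fin 2) (y : TorusSite 2 L) :
    |torusCosCoeff L (fun k => (selfEnergy L M β G (n, k) σ).re) y| ≤
      β * (L : ℝ) ^ 2 / (Fintype.card (SpaceTimeIdx L M) : ℝ) ^ 2 *
        ((∑ x : Fin 2 → SpaceTimeIdx L M, if y = (x 1).2 - (x 0).2 then
            ‖sectorisedKernel L M β (trivialMultiplier L M) G 2 (![((0, σ), 0), ((0, σ), 1)] : Fin 2 → SectorLeg 1) x‖ else 0) +
         (∑ x : Fin 2 → SpaceTimeIdx L M, if -y = (x 1).2 - (x 0).2 then
            ‖sectorisedKernel L M β (trivialMultiplier L M) G 2 (![((0, σ), 0), ((0, σ), 1)] : Fin 2 → SectorLeg 1) x‖ else 0)) := by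
  set P : ℝ := (Fintype.card (SpaceTimeIdx L M) : ℝ) with hP
  set F : TorusSite 2 L → ℂ := fun k => kernel ℂ G 2 ![(((n, k), σ), 0), (((n, k), σ), 1)] with hF
  have hL : (0 : ℝ) < (L : ℝ) ^ 2 := by have := NeZero.ne L; positivity
  -- the coefficient as two character sums
  have hcoeff : torusCosCoeff L (fun k => (selfEnergy L M β G (n, k) σ).re) y =
      ((L : ℝ) ^ 2)⁻¹ * (2 * (β * (L : ℝ) ^ 2)) *
        (((∑ k, F k * torusChar k y).re + (∑ k, F k * torusChar k (-y)).re) / 2) := by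
    unfold torusCosCoeff
    rw [mul_assoc]
    congr 1
    have hterm : ∀ k : TorusSite 2 L, (selfEnergy L M β G (n, k) σ).re *
        Real.cos (∑ i, latticeMomentum L k i * ((y i).valMinAbs : ℝ)) =
        2 * (β * (L : ℝ) ^ 2) * (((F k * torusChar k y).re + (F k * torusChar k (-y)).re) / 2) := by
      intro k
      rw [cos_latticeMomentum_valMinAbs_eq_re, selfEnergy_eq_vertexFn, Literature.Analysis.Complex.PowerSum.re_mul_re_eq,
        ← torusChar_neg_right]
      simp only [hF, mul_assoc, Complex.re_ofReal_mul]
      ring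
    simp_rw [hterm]
    rw [← mul_sum, Complex.re_sum, Complex.re_sum, ← sum_div, ← sum_add_distrib]
  rw [hcoeff]
  have h1 := norm_sum_kernel_two_mul_torusChar_le hβ.ne' G n σ y
  have h2 := norm_sum_kernel_two_mul_torusChar_le hβ.ne' G n σ (-y)
  have hr1 := (Complex.abs_re_le_norm (∑ k, F k * torusChar k y))
  have hr2 := (Complex.abs_re_le_norm (∑ k, F k * torusChar k (-y)))
  rw [abs_mul, abs_mul, abs_of_pos (inv_pos.2 hL), abs_of_pos (by positivity : (0:ℝ) < 2 * (β * (L : ℝ) ^ 2)), abs_div,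
    abs_two]
  have htri := abs_add_le (∑ k, F k * torusChar k y).re (∑ k, F k * torusChar k (-y)).re
  have hLne : ((L : ℝ) ^ 2) ≠ 0 := hL.ne'
  calc ((L : ℝ) ^ 2)⁻¹ * (2 * (β * (L : ℝ) ^ 2)) * (|(∑ k, F k * torusChar k y).re + (∑ k, F k * torusChar k (-y)).re| / 2)
      ≤ ((L : ℝ) ^ 2)⁻¹ * (2 * (β * (L : ℝ) ^ 2)) * ((‖∑ k, F k * torusChar k y‖ + ‖∑ k, F k * torusChar k (-y)‖) / 2) := by
        gcongr
        exact htri.trans (add_le_add hr1 hr2)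
    _ ≤ ((L : ℝ) ^ 2)⁻¹ * (2 * (β * (L : ℝ) ^ 2)) * (((L : ℝ) ^ 2 / P ^ 2 *
          (∑ x : Fin 2 → SpaceTimeIdx L M, if y = (x 1).2 - (x 0).2 then
            ‖sectorisedKernel L M β (trivialMultiplier L M) G 2 (![((0, σ), 0), ((0, σ), 1)] : Fin 2 → SectorLeg 1) x‖ else 0) +
          (L : ℝ) ^ 2 / P ^ 2 *
          (∑ x : Fin 2 → SpaceTimeIdx L M, if -y = (x 1).2 - (x 0).2 then
            ‖sectorisedKernel L M β (trivialMultiplier L M) G 2 (![((0, σ), 0), ((0, σ), 1)] : Fin 2 → SectorLeg 1) x‖ else 0)) / 2) := by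
        gcongr
    _ = _ := by
        field_simp

/-! ## §3 The weighted coefficient sums (moments) -/

omit [NeZero L] in
/-- The spatial weight `(1 + |z̃₀| + |z̃₁|)ʲ` is even on the torus. -/
theorem momentWeight_neg (j : ℕ) (z : TorusSite 2 L) :
    (1 + (((-z) 0).valMinAbs.natAbs : ℝ) + (((-z) 1).valMinAbs.natAbs : ℝ)) ^ j =
      (1 + ((z 0).valMinAbs.natAbs : ℝ) + ((z 1).valMinAbs.natAbs : ℝ)) ^ j := by
  simp only [Pi.neg_apply, ZMod.natAbs_valMinAbs_neg]

/-- **MOMENTS OF THE COSINE COEFFICIENTS OF `k⃗ ↦ Re Σ((ω,k⃗),σ)` FROM SPATIAL MOMENTS OF THE POSITION KERNEL.**  For `β > 0`, any `G`, a kept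
frequency `ω` and spin `σ`: if the string's unsectorised position kernel `W = sectorisedKernel β 1 G 2 ((σ,+),(σ,−))` has pinned spatial
`j`-th moment `ε_x Σ_{x : x 0 = x₀} (1 + |x̃₁ − x̃₀|₀ + |x̃₁ − x̃₀|₁)ʲ ‖W(x)‖ ≤ Mˢ` for every `x₀` (centred representatives of the torus difference
`x⃗₁ − x⃗₀`), then `Σ_y (1+|ỹ₀|+|ỹ₁|)ʲ |torusCosCoeff L (k⃗ ↦ Re Σ((ω,k⃗),σ)) y| ≤ 2·Mˢ`. [cite: BenfattoGiulianiMastropietro2006, §2.3 (2.17)] -/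
theorem sum_weight_abs_torusCosCoeff_re_selfEnergy_le [NeZero M] {β : ℝ} (hβ : 0 < β) (G : HubbardGrassmann L M)
    (n : MatsubaraIdx M) (σ : Fin 2) (j : ℕ) {Ms : ℝ}
    (hMs : ∀ x₀ : SpaceTimeIdx L M, imagTimeWeight β M *
      ∑ x ∈ (univ : Finset (Fin 2 → SpaceTimeIdx L M)).filter (fun x => x 0 = x₀),
        (1 + ((((x 1).2 - (x 0).2) 0).valMinAbs.natAbs : ℝ) + ((((x 1).2 - (x 0).2) 1).valMinAbs.natAbs : ℝ)) ^ j *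
          ‖sectorisedKernel L M β (trivialMultiplier L M) G 2 (![((0, σ), 0), ((0, σ), 1)] : Fin 2 → SectorLeg 1) x‖ ≤ Ms) :
    ∑ y : TorusSite 2 L, (1 + ((y 0).valMinAbs.natAbs : ℝ) + ((y 1).valMinAbs.natAbs : ℝ)) ^ j *
        |torusCosCoeff L (fun k => (selfEnergy L M β G (n, k) σ).re) y| ≤ 2 * Ms := by
  set W := sectorisedKernel L M β (trivialMultiplier L M) G 2 (![((0, σ), 0), ((0, σ), 1)] : Fin 2 → SectorLeg 1) with hW
  set w : TorusSite 2 L → ℝ := fun z => (1 + ((z 0).valMinAbs.natAbs : ℝ) + ((z 1).valMinAbs.natAbs : ℝ)) ^ j with hw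
  set d : (Fin 2 → SpaceTimeIdx L M) → TorusSite 2 L := fun x => (x 1).2 - (x 0).2 with hd
  set P : ℝ := (Fintype.card (SpaceTimeIdx L M) : ℝ) with hP
  have hPpos : 0 < P := by
    rw [hP]; exact_mod_cast (Fintype.card_pos_iff.2 ⟨(n, 0)⟩ : 0 < Fintype.card (SpaceTimeIdx L M))
  have hεpos : 0 < imagTimeWeight β M := by
    unfold imagTimeWeight
    have : (0 : ℝ) < M := by
      have hM : 0 < 2 * M := n.pos
      exact_mod_cast Nat.pos_of_mul_pos_left hM
    positivity
  have hεP : imagTimeWeight β M * P = β * (L : ℝ) ^ 2 := imagTimeWeight_mul_card β L M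
  have hw0 : ∀ z, 0 ≤ w z := fun z => by rw [hw]; positivity
  have hweven : ∀ z, w (-z) = w z := fun z => by simp only [hw]; exact momentWeight_neg j z
  -- the spatial moment over all tuples, sliced by the pinned leg
  have htot : ∑ x : Fin 2 → SpaceTimeIdx L M, w (d x) * ‖W x‖ ≤ P * (Ms / imagTimeWeight β M) := by
    rw [← sum_fiberwise_of_maps_to (s := univ) (t := (univ : Finset (SpaceTimeIdx L M))) (g := fun x => x 0)
      (fun _ _ => mem_univ _)]
    have hPsum : P * (Ms / imagTimeWeight β M) = ∑ _x₀ : SpaceTimeIdx L M, Ms / imagTimeWeight β M := by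
      rw [sum_const, card_univ, nsmul_eq_mul, hP]
    rw [hPsum]
    refine sum_le_sum fun x₀ _ => ?_
    rw [le_div_iff₀ hεpos, mul_comm]
    exact hMs x₀
  -- the two collapsed sums
  have hN : ∑ y : TorusSite 2 L, w y * (∑ x : Fin 2 → SpaceTimeIdx L M, if y = d x then ‖W x‖ else 0) =
      ∑ x : Fin 2 → SpaceTimeIdx L M, w (d x) * ‖W x‖ := by
    simp_rw [mul_sum, mul_ite, mul_zero]
    rw [sum_comm]
    refine sum_congr rfl fun x _ => ?_
    rw [sum_ite_eq' univ (d x) (fun y => w y * ‖W x‖), if_pos (mem_univ _)]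
  have hN' : ∑ y : TorusSite 2 L, w y * (∑ x : Fin 2 → SpaceTimeIdx L M, if -y = d x then ‖W x‖ else 0) =
      ∑ x : Fin 2 → SpaceTimeIdx L M, w (d x) * ‖W x‖ := by
    simp_rw [mul_sum, mul_ite, mul_zero, neg_eq_iff_eq_neg]
    rw [sum_comm]
    refine sum_congr rfl fun x _ => ?_
    rw [sum_ite_eq' univ (-d x) (fun y => w y * ‖W x‖), if_pos (mem_univ _), hweven]
  -- pointwise bound, summed
  have hpt : ∀ y, w y * |torusCosCoeff L (fun k => (selfEnergy L M β G (n, k) σ).re) y| ≤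
      w y * (β * (L : ℝ) ^ 2 / P ^ 2 * ((∑ x : Fin 2 → SpaceTimeIdx L M, if y = d x then ‖W x‖ else 0) +
        (∑ x : Fin 2 → SpaceTimeIdx L M, if -y = d x then ‖W x‖ else 0))) := fun y =>
    mul_le_mul_of_nonneg_left (abs_torusCosCoeff_re_selfEnergy_le hβ G n σ y) (hw0 y)
  calc ∑ y, w y * |torusCosCoeff L (fun k => (selfEnergy L M β G (n, k) σ).re) y|
      ≤ ∑ y, w y * (β * (L : ℝ) ^ 2 / P ^ 2 * ((∑ x : Fin 2 → SpaceTimeIdx L M, if y = d x then ‖W x‖ else 0) +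
          (∑ x : Fin 2 → SpaceTimeIdx L M, if -y = d x then ‖W x‖ else 0))) := sum_le_sum fun y _ => hpt y
    _ = β * (L : ℝ) ^ 2 / P ^ 2 * ((∑ y : TorusSite 2 L, w y * (∑ x : Fin 2 → SpaceTimeIdx L M, if y = d x then ‖W x‖ else 0)) +
          (∑ y : TorusSite 2 L, w y * (∑ x : Fin 2 → SpaceTimeIdx L M, if -y = d x then ‖W x‖ else 0))) := by
        rw [← sum_add_distrib, mul_sum]
        refine sum_congr rfl fun y _ => ?_
        ring
    _ = β * (L : ℝ) ^ 2 / P ^ 2 * (∑ x : Fin 2 → SpaceTimeIdx L M, w (d x) * ‖W x‖ +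
          ∑ x : Fin 2 → SpaceTimeIdx L M, w (d x) * ‖W x‖) := by rw [hN, hN']
    _ ≤ β * (L : ℝ) ^ 2 / P ^ 2 * (P * (Ms / imagTimeWeight β M) + P * (Ms / imagTimeWeight β M)) := by
        gcongr
    _ = 2 * Ms := by
        rw [← hεP]
        field_simp
        ring

section Model

variable [NeZero M]

/-- **MOMENTS OF THE CELL'S TWO-LEG DATA FROM THE POSITION KERNEL**: for the scale-`n` action `klEffectiveAction … K klE0 n` with unsectorised
two-leg position kernels `W_σ` (`σ = ↑,↓`) of pinned spatial `j`-th moment `≤ Mˢ`, the lattice cosine coefficients of the localised two-leg value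
`klLocSelfEnergyRe … n` (the `±ω₀`/spin average of `Re Σ_n`) have `j`-th moment `≤ 2·Mˢ` — the hypothesis `hm` of `twoLegAngularG_of_moments` /
`twoLegAngularFn_of_moments_and_curve` and (via `coeffNorm`) of the (E3e)/(E3a) closers, now in the engine's position-space language. -/
theorem sum_weight_abs_torusCosCoeff_klLocSelfEnergyRe_le {β : ℝ} (hβ : 0 < β) (U μ : ℝ) (K : TrigPolyC4v) (n j : ℕ) {Ms : ℝ}
    (hMs : ∀ (σ : Fin 2) (x₀ : SpaceTimeIdx L M), imagTimeWeight β M *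
      ∑ x ∈ (univ : Finset (Fin 2 → SpaceTimeIdx L M)).filter (fun x => x 0 = x₀),
        (1 + ((((x 1).2 - (x 0).2) 0).valMinAbs.natAbs : ℝ) + ((((x 1).2 - (x 0).2) 1).valMinAbs.natAbs : ℝ)) ^ j *
          ‖sectorisedKernel L M β (trivialMultiplier L M) (KLProgrammeLegKernels.klEffectiveAction L M β U μ K klE0 n) 2
            (![((0, σ), 0), ((0, σ), 1)] : Fin 2 → SectorLeg 1) x‖ ≤ Ms) :
    ∑ y : TorusSite 2 L, (1 + ((y 0).valMinAbs.natAbs : ℝ) + ((y 1).valMinAbs.natAbs : ℝ)) ^ j *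
        |torusCosCoeff L (klLocSelfEnergyRe L M β U μ K n) y| ≤ 2 * Ms := by
  set G := KLProgrammeLegKernels.klEffectiveAction L M β U μ K klE0 n with hG
  set w : TorusSite 2 L → ℝ := fun z => (1 + ((z 0).valMinAbs.natAbs : ℝ) + ((z 1).valMinAbs.natAbs : ℝ)) ^ j with hw
  have hw0 : ∀ z, 0 ≤ w z := fun z => by rw [hw]; positivity
  -- the data as the average of four real parts
  set f : MatsubaraIdx M → Fin 2 → TorusSite 2 L → ℝ := fun m σ k => (selfEnergy L M β G (m, k) σ).re with hf
  have hdata : klLocSelfEnergyRe L M β U μ K n = fun k => (1 / 4 : ℝ) *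
      ((f (omega0 M) 0 k + f (omega0 M).rev 0 k) + (f (omega0 M) 1 k + f (omega0 M).rev 1 k)) := by
    funext k
    simp only [klLocSelfEnergyRe, KLProgrammeLegKernels.klSelfEnergy, hf, hG, Fin.sum_univ_two]
    ring
  have hcoeff : ∀ y, torusCosCoeff L (klLocSelfEnergyRe L M β U μ K n) y = (1 / 4 : ℝ) *
      ((torusCosCoeff L (f (omega0 M) 0) y + torusCosCoeff L (f (omega0 M).rev 0) y) +
        (torusCosCoeff L (f (omega0 M) 1) y + torusCosCoeff L (f (omega0 M).rev 1) y)) := by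
    intro y
    rw [hdata, torusCosCoeff_const_mul, torusCosCoeff_add L (fun k => f (omega0 M) 0 k + f (omega0 M).rev 0 k)
      (fun k => f (omega0 M) 1 k + f (omega0 M).rev 1 k), torusCosCoeff_add, torusCosCoeff_add]
  have hb : ∀ (m : MatsubaraIdx M) (σ : Fin 2), ∑ y, w y * |torusCosCoeff L (f m σ) y| ≤ 2 * Ms := fun m σ =>
    sum_weight_abs_torusCosCoeff_re_selfEnergy_le hβ G m σ j (hMs σ)
  have hpt : ∀ y, w y * |torusCosCoeff L (klLocSelfEnergyRe L M β U μ K n) y| ≤ (1 / 4 : ℝ) *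
      ((w y * |torusCosCoeff L (f (omega0 M) 0) y| + w y * |torusCosCoeff L (f (omega0 M).rev 0) y|) +
        (w y * |torusCosCoeff L (f (omega0 M) 1) y| + w y * |torusCosCoeff L (f (omega0 M).rev 1) y|)) := by
    intro y
    rw [hcoeff, abs_mul, abs_of_pos (by norm_num : (0 : ℝ) < 1 / 4)]
    have h1 := abs_add_le (torusCosCoeff L (f (omega0 M) 0) y + torusCosCoeff L (f (omega0 M).rev 0) y)
      (torusCosCoeff L (f (omega0 M) 1) y + torusCosCoeff L (f (omega0 M).rev 1) y)
    have h2 := abs_add_le (torusCosCoeff L (f (omega0 M) 0) y) (torusCosCoeff L (f (omega0 M).rev 0) y)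
    have h3 := abs_add_le (torusCosCoeff L (f (omega0 M) 1) y) (torusCosCoeff L (f (omega0 M).rev 1) y)
    have hwy := hw0 y
    nlinarith
  calc ∑ y, w y * |torusCosCoeff L (klLocSelfEnergyRe L M β U μ K n) y|
      ≤ ∑ y, (1 / 4 : ℝ) * ((w y * |torusCosCoeff L (f (omega0 M) 0) y| + w y * |torusCosCoeff L (f (omega0 M).rev 0) y|) +
          (w y * |torusCosCoeff L (f (omega0 M) 1) y| + w y * |torusCosCoeff L (f (omega0 M).rev 1) y|)) :=
        sum_le_sum fun y _ => hpt y
    _ = (1 / 4 : ℝ) * ((∑ y, w y * |torusCosCoeff L (f (omega0 M) 0) y| + ∑ y, w y * |torusCosCoeff L (f (omega0 M).rev 0) y|) +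
          (∑ y, w y * |torusCosCoeff L (f (omega0 M) 1) y| + ∑ y, w y * |torusCosCoeff L (f (omega0 M).rev 1) y|)) := by
        rw [← mul_sum, sum_add_distrib, sum_add_distrib, sum_add_distrib]
    _ ≤ (1 / 4 : ℝ) * ((2 * Ms + 2 * Ms) + (2 * Ms + 2 * Ms)) := by
        gcongr
        · exact hb _ _
        · exact hb _ _
        · exact hb _ _
        · exact hb _ _
    _ = 2 * Ms := by ring

end Model

/-! ## §4 (E3d/e) end to end: `TwoLegSlopes` in the KL regime from two position-space numbers -/

section Regime

variable [NeZero M]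

/-- **The gradient of the two-leg interpolant from the pinned spatial FIRST moment**: `‖D(evalM S_n)(q)‖ ≤ 2·Mˢ₁`
(`‖D¹‖ ≤ coeffNorm 1 ≤` first coefficient moment `≤ 2Mˢ₁`). -/
theorem norm_fderiv_evalM_twoLegPoly_le_of_position_moment {β : ℝ} (hβ : 0 < β) (U μ : ℝ) (K : TrigPolyC4v) (n : ℕ) {Ms : ℝ}
    (hMs : ∀ (σ : Fin 2) (x₀ : SpaceTimeIdx L M), imagTimeWeight β M *
      ∑ x ∈ (univ : Finset (Fin 2 → SpaceTimeIdx L M)).filter (fun x => x 0 = x₀),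
        (1 + ((((x 1).2 - (x 0).2) 0).valMinAbs.natAbs : ℝ) + ((((x 1).2 - (x 0).2) 1).valMinAbs.natAbs : ℝ)) ^ 1 *
          ‖sectorisedKernel L M β (trivialMultiplier L M) (KLProgrammeLegKernels.klEffectiveAction L M β U μ K klE0 n) 2
            (![((0, σ), 0), ((0, σ), 1)] : Fin 2 → SectorLeg 1) x‖ ≤ Ms) (q : Momentum) :
    ‖fderiv ℝ (evalM (symInterp L (klLocSelfEnergyRe L M β U μ K n))) q‖ ≤ 2 * Ms := by
  rw [← norm_iteratedFDeriv_one]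
  exact (norm_iteratedFDeriv_evalM_le_coeffNorm _ 1 q).trans ((coeffNorm_symInterp_le _ 1).trans
    (sum_weight_abs_torusCosCoeff_klLocSelfEnergyRe_le hβ U μ K n 1 hMs))

/-- **(E3d/e) `TwoLegSlopes` FOR EVERY ADMISSIBLE FRAME IN THE KL REGIME FROM TWO POSITION-SPACE NUMBERS OF THE ENGINE.**  For every `R`
(`Gfr ≥ 0`) there are `c₃, U₀, D > 0` such that, in the regime (`0 < c ≤ c₃`, `0 < U ≤ U₀`, `klBetaMin ≤ β ≤ e^{c/U²}`, `μ ∈ klWindowC`,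
`FrameOK R U (nScales β) μ K`), for all volumes and scales: if the unsectorised position-space two-leg kernels `W_σ` of the scale-`n` action
(both spin strings, leg `0` pinned, weight `ε_x`) have spatial first moment `≤ Mˢ` with `2Mˢ ≤ cz·|U|·D` and temporal first moment `≤ Mᵗ` with
`2Mᵗ ≤ cz·|U|`, then `TwoLegSlopes L M R β U μ K n`.  (D = Dt_min/2 of `bandBounds (−1.2) (−0.05)`.) [cite: BenfattoGiulianiMastropietro2006, (2.36)] -/
theorem twoLegSlopes_of_frameOK_regime_of_position_moments (R : RenConsts) (hR : ∀ j, 0 ≤ R.Gfr j) :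
    ∃ c₃ : ℝ, 0 < c₃ ∧ ∃ U₀ : ℝ, 0 < U₀ ∧ ∃ D : ℝ, 0 < D ∧
      ∀ c : ℝ, 0 < c → c ≤ c₃ → ∀ U : ℝ, 0 < U → U ≤ U₀ → ∀ β : ℝ, klBetaMin ≤ β → β ≤ Real.exp (c / U ^ 2) →
      ∀ μ ∈ klWindowC, ∀ K : TrigPolyC4v, FrameOK R U (nScales β) μ K →
        ∀ (L M : ℕ) [NeZero L] [NeZero M] (n : ℕ) (Ms Mt : ℝ), 0 ≤ Ms →
          (∀ (σ : Fin 2) (x₀ : SpaceTimeIdx L M), imagTimeWeight β M *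
            ∑ x ∈ (univ : Finset (Fin 2 → SpaceTimeIdx L M)).filter (fun x => x 0 = x₀),
              (1 + ((((x 1).2 - (x 0).2) 0).valMinAbs.natAbs : ℝ) + ((((x 1).2 - (x 0).2) 1).valMinAbs.natAbs : ℝ)) ^ 1 *
                ‖sectorisedKernel L M β (trivialMultiplier L M) (KLProgrammeLegKernels.klEffectiveAction L M β U μ K klE0 n) 2
                  (![((0, σ), 0), ((0, σ), 1)] : Fin 2 → SectorLeg 1) x‖ ≤ Ms) →
          (∀ (σ : Fin 2) (x₀ : SpaceTimeIdx L M), imagTimeWeight β M *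
            ∑ x ∈ (univ : Finset (Fin 2 → SpaceTimeIdx L M)).filter (fun x => x 0 = x₀),
              imagTimeWeight β M * (circDist (2 * M) (x 0).1.val (x 1).1.val : ℝ) *
                ‖sectorisedKernel L M β (trivialMultiplier L M) (KLProgrammeLegKernels.klEffectiveAction L M β U μ K klE0 n) 2
                  (![((0, σ), 0), ((0, σ), 1)] : Fin 2 → SectorLeg 1) x‖ ≤ Mt) →
          2 * Ms ≤ R.cz * |U| * D → 2 * Mt ≤ R.cz * |U| →
            TwoLegSlopes L M R β U μ K n := by
  obtain ⟨c₃, hc₃, U₀, hU₀, D, hD, h⟩ := twoLegSlopes_of_frameOK_regime R hR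
  refine ⟨c₃, hc₃, U₀, hU₀, D, hD, ?_⟩
  intro c hc hcle U hU hUle β hβmin hβc μ hμ K hK L M _ _ n Ms Mt hMs0 hMs hMt hMsD hMtU
  have hβ : 0 < β := lt_of_lt_of_le (by unfold klBetaMin; positivity) hβmin
  refine h c hc hcle U hU hUle β hβmin hβc μ hμ K hK L M n (2 * Ms) (by positivity)
    (norm_fderiv_evalM_twoLegPoly_le_of_position_moment hβ U μ K n hMs) hMsD ?_
  intro k _
  exact (abs_klFieldStrength_sub_one_le_of_time_moment hβ U μ K n k hMt).trans hMtU

end Regime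

end Summit.HubbardSuperconductivity.HubbardSuperconductivity.Theorems.TwoLegFourier

end
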